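import Summits.MatrixMultiplication.OmegaCensus.GoldenClassTable1
import Summits.MatrixMultiplication.OmegaCensus.GoldenClassTable2
import Summits.MatrixMultiplication.OmegaCensus.GoldenClassTable3
import Summits.MatrixMultiplication.OmegaCensus.GoldenClassTable4
import Summits.MatrixMultiplication.OmegaCensus.GoldenClassTable5
import Summits.MatrixMultiplication.OmegaCensus.GoldenClassTable6
import Summits.MatrixMultiplication.OmegaCensus.GoldenClassTable7
import Summits.MatrixMultiplication.OmegaCensus.PhaseArcThue

/-!
# ω-census, family (b3): conjecture C9 — the UNIFORM THEOREM for the golden groups: `𝔽_p[ζ₅] ⋊ C₅` is not box-useful for every prime `p ≥ 400`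

HONEST FRAMING (pub-omega census; verbatim): lottery ticket; floor = certified bounds/negative ranges.
Census BOOKKEEPING (conjecture C9 of the cell; pub-omega stpp-1 gen 22).  Assembly of `GoldenClassCheck` / `GoldenUniform` /
`GoldenCounts` with the 48-class table `GoldenClassTable1–7`:
* `table_key`: every primitive residue pair `(γ₀, γ₁) ∈ (ℤ/8)²` has a class datum passing `ClassOKG 0 γ₀ γ₁ Smax` and the
  numeric envelope `EnvOK MIS Σt Smax 20 400` (64-way case split over the landed `decide` lemmas);
* **`GoldCyc.not_boxUseful_ge`**: for every prime `p ≥ 400` and every `τ` with `τ² + τ = 1`, `¬ BoxUseful (GoldCyc p τ)`.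
  Proof: Thue (`PhaseArcs.thue_primitive`) gives `0 < x`, `x², y² ≤ p`, `y ≡ τx`, not both even; `ε = max |x| |y|` (`ε² ≤ p`);
  the residues `γ₀ = −px`, `γ₁ = −py (mod 8)` are primitive since `p` is odd; `table_key` + `env_of_envOK` give the class check
  and both size conditions; conclude by `not_boxUseful_of_classOKG`.
The primes below `400` are covered by per-prime certificates / explicit patterns; the all-`p` statement is assembled in
`GoldenAll.lean`.  Nothing here is progress on `ω`.
-/

namespace Summit.MatrixMultiplication.OmegaCensus

namespace GoldArcs

/-- All elements of `ZMod 8`. [folklore] -/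
theorem zmod8_cases : ∀ k : ZMod 8, k = 0 ∨ k = 1 ∨ k = 2 ∨ k = 3 ∨ k = 4 ∨ k = 5 ∨ k = 6 ∨ k = 7 := by decide

/-- **Every primitive class passes**: class check with sign datum `0` and the numeric envelope at `s = 20`, `P₀ = 400`. [folklore] -/
theorem table_key (γ₀ γ₁ : ZMod 8) (h : ¬ (2 ∣ γ₀.val ∧ 2 ∣ γ₁.val)) :
    ∃ cd : ClassDataG, ∃ Smax : ℕ, cd.ClassOKG 0 γ₀ γ₁ Smax ∧ EnvOK cd.MIS cd.SigT Smax 20 400 := by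
  rcases zmod8_cases γ₀ with rfl | rfl | rfl | rfl | rfl | rfl | rfl | rfl <;>
  rcases zmod8_cases γ₁ with rfl | rfl | rfl | rfl | rfl | rfl | rfl | rfl
  · exact (h (by decide)).elim
  · exact ⟨cdG_0_1, 3, cdG_0_1_ok, cdG_0_1_env⟩
  · exact (h (by decide)).elim
  · exact ⟨cdG_0_3, 3, cdG_0_3_ok, cdG_0_3_env⟩
  · exact (h (by decide)).elim
  · exact ⟨cdG_0_5, 3, cdG_0_5_ok, cdG_0_5_env⟩
  · exact (h (by decide)).elim
  · exact ⟨cdG_0_7, 3, cdG_0_7_ok, cdG_0_7_env⟩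
  · exact ⟨cdG_1_0, 3, cdG_1_0_ok, cdG_1_0_env⟩
  · exact ⟨cdG_1_1, 3, cdG_1_1_ok, cdG_1_1_env⟩
  · exact ⟨cdG_1_2, 3, cdG_1_2_ok, cdG_1_2_env⟩
  · exact ⟨cdG_1_3, 3, cdG_1_3_ok, cdG_1_3_env⟩
  · exact ⟨cdG_1_4, 3, cdG_1_4_ok, cdG_1_4_env⟩
  · exact ⟨cdG_1_5, 3, cdG_1_5_ok, cdG_1_5_env⟩
  · exact ⟨cdG_1_6, 3, cdG_1_6_ok, cdG_1_6_env⟩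
  · exact ⟨cdG_1_7, 3, cdG_1_7_ok, cdG_1_7_env⟩
  · exact (h (by decide)).elim
  · exact ⟨cdG_2_1, 3, cdG_2_1_ok, cdG_2_1_env⟩
  · exact (h (by decide)).elim
  · exact ⟨cdG_2_3, 3, cdG_2_3_ok, cdG_2_3_env⟩
  · exact (h (by decide)).elim
  · exact ⟨cdG_2_5, 3, cdG_2_5_ok, cdG_2_5_env⟩
  · exact (h (by decide)).elim
  · exact ⟨cdG_2_7, 3, cdG_2_7_ok, cdG_2_7_env⟩
  · exact ⟨cdG_3_0, 3, cdG_3_0_ok, cdG_3_0_env⟩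
  · exact ⟨cdG_3_1, 3, cdG_3_1_ok, cdG_3_1_env⟩
  · exact ⟨cdG_3_2, 3, cdG_3_2_ok, cdG_3_2_env⟩
  · exact ⟨cdG_3_3, 4, cdG_3_3_ok, cdG_3_3_env⟩
  · exact ⟨cdG_3_4, 3, cdG_3_4_ok, cdG_3_4_env⟩
  · exact ⟨cdG_3_5, 3, cdG_3_5_ok, cdG_3_5_env⟩
  · exact ⟨cdG_3_6, 4, cdG_3_6_ok, cdG_3_6_env⟩
  · exact ⟨cdG_3_7, 2, cdG_3_7_ok, cdG_3_7_env⟩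
  · exact (h (by decide)).elim
  · exact ⟨cdG_4_1, 2, cdG_4_1_ok, cdG_4_1_env⟩
  · exact (h (by decide)).elim
  · exact ⟨cdG_4_3, 3, cdG_4_3_ok, cdG_4_3_env⟩
  · exact (h (by decide)).elim
  · exact ⟨cdG_4_5, 3, cdG_4_5_ok, cdG_4_5_env⟩
  · exact (h (by decide)).elim
  · exact ⟨cdG_4_7, 3, cdG_4_7_ok, cdG_4_7_env⟩
  · exact ⟨cdG_5_0, 3, cdG_5_0_ok, cdG_5_0_env⟩
  · exact ⟨cdG_5_1, 3, cdG_5_1_ok, cdG_5_1_env⟩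
  · exact ⟨cdG_5_2, 3, cdG_5_2_ok, cdG_5_2_env⟩
  · exact ⟨cdG_5_3, 3, cdG_5_3_ok, cdG_5_3_env⟩
  · exact ⟨cdG_5_4, 4, cdG_5_4_ok, cdG_5_4_env⟩
  · exact ⟨cdG_5_5, 3, cdG_5_5_ok, cdG_5_5_env⟩
  · exact ⟨cdG_5_6, 3, cdG_5_6_ok, cdG_5_6_env⟩
  · exact ⟨cdG_5_7, 3, cdG_5_7_ok, cdG_5_7_env⟩
  · exact (h (by decide)).elim
  · exact ⟨cdG_6_1, 2, cdG_6_1_ok, cdG_6_1_env⟩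
  · exact (h (by decide)).elim
  · exact ⟨cdG_6_3, 2, cdG_6_3_ok, cdG_6_3_env⟩
  · exact (h (by decide)).elim
  · exact ⟨cdG_6_5, 3, cdG_6_5_ok, cdG_6_5_env⟩
  · exact (h (by decide)).elim
  · exact ⟨cdG_6_7, 2, cdG_6_7_ok, cdG_6_7_env⟩
  · exact ⟨cdG_7_0, 3, cdG_7_0_ok, cdG_7_0_env⟩
  · exact ⟨cdG_7_1, 3, cdG_7_1_ok, cdG_7_1_env⟩
  · exact ⟨cdG_7_2, 3, cdG_7_2_ok, cdG_7_2_env⟩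
  · exact ⟨cdG_7_3, 3, cdG_7_3_ok, cdG_7_3_env⟩
  · exact ⟨cdG_7_4, 3, cdG_7_4_ok, cdG_7_4_env⟩
  · exact ⟨cdG_7_5, 3, cdG_7_5_ok, cdG_7_5_env⟩
  · exact ⟨cdG_7_6, 3, cdG_7_6_ok, cdG_7_6_env⟩
  · exact ⟨cdG_7_7, 3, cdG_7_7_ok, cdG_7_7_env⟩

end GoldArcs

namespace GoldCyc

open GoldArcs

/-- **UNIFORM THEOREM (golden family).** For every prime `p ≥ 400` and every `τ ∈ 𝔽_p` with `τ² + τ = 1`, the golden group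
`𝔽_p[ζ] ⋊_ζ ℤ/5 = GoldCyc p τ` (order `5p²`) is not box-useful. [folklore] -/
theorem not_boxUseful_ge {p : ℕ} [Fact p.Prime] (hp : 400 ≤ p) {τ : ZMod p} [hτ : Fact (τ ^ 2 + τ = 1)] :
    ¬ BoxUseful (GoldCyc p τ) := by
  have hprime : p.Prime := Fact.out
  have hodd : Odd p := hprime.odd_of_ne_two (by omega)
  obtain ⟨x, y, hx0, hxx, hyy, hyx, hprim⟩ := PhaseArcs.thue_primitive p (by omega) hodd τ
  -- `ε = max |x| |y|`
  obtain ⟨ε, hxe, hye, hεp⟩ : ∃ ε : ℕ, |x| ≤ (ε : ℤ) ∧ |y| ≤ (ε : ℤ) ∧ (ε : ℤ) * ε ≤ p := by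
    by_cases hle : |y| ≤ |x|
    · refine ⟨x.natAbs, ?_, ?_, ?_⟩ <;> rw [Int.natCast_natAbs]
      · exact hle
      · nlinarith [sq_abs x, abs_nonneg x]
    · refine ⟨y.natAbs, ?_, ?_, ?_⟩ <;> rw [Int.natCast_natAbs]
      · exact (not_le.1 hle).le
      · nlinarith [sq_abs y, abs_nonneg y]
  -- `x ≢ 0 (mod p)`
  have hxp : (x : ZMod p) ≠ 0 := by
    intro h
    rw [ZMod.intCast_zmod_eq_zero_iff_dvd] at h
    have h1 := Int.le_of_dvd hx0 h
    have h2 : (2 : ℤ) ≤ p := by exact_mod_cast hprime.two_le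
    nlinarith
  -- the residues are primitive
  set γ₀ : ZMod 8 := -((p : ZMod 8) * x) with hγ₀
  set γ₁ : ZMod 8 := -((p : ZMod 8) * y) with hγ₁
  obtain ⟨k, hk⟩ := hodd
  have hval : ∀ z : ℤ, ((-((p : ZMod 8) * z)).val : ℤ) = (-((p : ℤ) * z)) % 8 := by
    intro z
    have : (-((p : ZMod 8) * z)) = (((-((p : ℤ) * z)) : ℤ) : ZMod 8) := by push_cast; ring
    rw [this, ZMod.val_intCast]
    norm_num
  have hpar : ∀ z : ℤ, 2 ∣ (-((p : ZMod 8) * z)).val → 2 ∣ z := by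
    intro z ⟨c, hc⟩
    have h1 := hval z
    rw [hc] at h1
    push_cast at h1
    have h2 := Int.emod_add_mul_ediv (-((p : ℤ) * z)) 8
    refine ⟨-(c : ℤ) - 4 * (-((p : ℤ) * z) / 8) - (k : ℤ) * z, ?_⟩
    have hk' : (p : ℤ) = 2 * k + 1 := by exact_mod_cast hk
    linear_combination h1 + h2 - z * hk'
  have hprim' : ¬ (2 ∣ γ₀.val ∧ 2 ∣ γ₁.val) := fun ⟨h0, h1⟩ => hprim ⟨hpar x h0, hpar y h1⟩
  -- the table
  obtain ⟨cd, Smax, hok, henv⟩ := table_key γ₀ γ₁ hprim'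
  obtain ⟨hcount, hS⟩ := env_of_envOK henv (q := (p : ℤ)) (by exact_mod_cast hp) (Nat.cast_nonneg ε) hεp
  exact not_boxUseful_of_classOKG (by omega) x y hxp hyx hx0 (σ := 0) (fun h => by norm_num at h) (fun h => by norm_num at h)
    hxe hye cd rfl rfl hok (by exact_mod_cast hS) hcount

end GoldCyc

end Summit.MatrixMultiplication.OmegaCensus
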